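import Mathlib
import HarnessLib
import Summits.ValiantsHypothesis.ValiantsHypothesis.Theorems.LacunarySymmetroidMatrixDescartesOsculationLawPeelPigeonhole
import Summits.ValiantsHypothesis.ValiantsHypothesis.Theorems.LacunarySymmetroidMatrixDescartesOsculationLawPeelRankTwoArcCount

/-!
# ValiantsHypothesis / LacunarySymmetroid — crux `MatrixDescartes` (stmt-ValiantsHypothesis-18050, V1),
# line `Cruxes/MatrixDescartes/Lines/osculation_law.lean` («osculation-law»), stub `stub_peel` at RANK TWO:
# THE CURVE FORM (step (B5b) of HOME/lmr/NOTE-p7g12-peel-r2-plan.md)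

`peel_curve_two`: for a HYPERBOLIC quadratic spectral curve `Φ = X₁X₁·ι a + X₁·ι e + ι f` (`4af ≤ e²`, `a ≢ 0`,
`f ≢ 0`) whose osculation set in the open quadrant is finite, with every osculation point smooth (`∂_bΦ ≠ 0`) and
off the arc `b = c·t^N` (`c > 0`),
**`Z₊mult(a·(cX^N)² + e·(cX^N) + f) ≤ 2·#osc + 2·2 + 2·Z₊mult(f) + 3·Z₊mult(a)`** — the `r = 2` instance of the
line's `PeelInequality` in curve form (the pencil-level unfolding, via `OsculationRankTwo.insertionPoly_two` /
`det_add_smul_blockProj_two` / `hdisc_two`, is step (B5c)).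

Proof = the per-branch cut scheme of the memo: every positive root of `g` lies on exactly one branch `σ ∈ {+1,−1}`
(`β_σ = (−e + σ√Δ)/2a` off the poles, `−f/e` at its regular poles, ownership `a ≠ 0 ∨ σe > 0`); branch `σ` is cut
at its own zeros `{f = 0, σe ≥ 0}`, its escapes `{a = 0, σe ≤ 0}` and its own osculation abscissae; a double zero /
double escape costs multiplicity two (`…PeelRankTwoEvents`), the two families of osculation abscissae are disjoint, so
the cuts total `≤ Z₊mult(f) + Z₊mult(a) + #osc`; roots avoid their own cuts (general position), every own-cut-free
arc carries at most two of them (`branch_arc_count_two`), and the pigeonhole `card_le_mul_card_cuts_succ` per branch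
gives `2#osc + 4 + 2Z(f) + 2Z(a)`.  Honest framing: the curve form of the `r = 2` INSTANCE of an OPEN stub;
`stub_peel` (all ranks), the LAW, `MatrixDescartes`, Conjecture B and `VP ≠ VNP` are NOT proved.  No definitions
(the branches are local lambda terms), no named facts.
-/

-- `Summit.ValiantsHypothesis.ValiantsHypothesis.…` is the tree's mandated single-conjunct layout (Sub = Summit).
set_option linter.dupNamespace false

noncomputable section

namespace Summit.ValiantsHypothesis.ValiantsHypothesis.Theorems.LacunarySymmetroidMatrixDescartes

open Polynomial Set
open scoped BigOperators Topology

namespace OsculationPeel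

/-- **Counting with multiplicity**: two finsets of positive roots of `p` whose common elements are multiple roots
have total size at most `Z₊mult(p)`. [folklore] -/
theorem card_add_card_le_card_roots (p : ℝ[X]) (hp : p ≠ 0) (S₁ S₂ : Finset ℝ)
    (h₁ : ∀ t ∈ S₁, 0 < t ∧ p.IsRoot t) (h₂ : ∀ t ∈ S₂, 0 < t ∧ p.IsRoot t)
    (h₁₂ : ∀ t ∈ S₁, t ∈ S₂ → 1 < p.rootMultiplicity t) :
    S₁.card + S₂.card ≤ Multiset.card (p.roots.filter (fun t => 0 < t)) := by
  classical
  set M := p.roots.filter (fun t => 0 < t) with hM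
  have hsub : S₁ ∪ S₂ ⊆ M.toFinset := by
    intro t ht
    rw [Multiset.mem_toFinset, hM, Multiset.mem_filter, mem_roots hp]
    rcases Finset.mem_union.1 ht with h | h
    · exact ⟨(h₁ t h).2, (h₁ t h).1⟩
    · exact ⟨(h₂ t h).2, (h₂ t h).1⟩
  have hcount : ∀ t ∈ S₁ ∪ S₂, M.count t = p.rootMultiplicity t := by
    intro t ht
    have hpos : 0 < t := by
      rcases Finset.mem_union.1 ht with h | h
      · exact (h₁ t h).1
      · exact (h₂ t h).1
    rw [hM, Multiset.count_filter_of_pos hpos, count_roots]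
  have hsum : Multiset.card M = ∑ t ∈ M.toFinset, M.count t := (Multiset.toFinset_sum_count_eq M).symm
  have hge1 : ∀ t ∈ S₁ ∪ S₂, 1 ≤ M.count t := by
    intro t ht
    rw [hcount t ht]
    have hr : p.IsRoot t := by
      rcases Finset.mem_union.1 ht with h | h
      · exact (h₁ t h).2
      · exact (h₂ t h).2
    exact (rootMultiplicity_pos hp).2 hr
  have hge2 : ∀ t ∈ S₁ ∩ S₂, 2 ≤ M.count t := by
    intro t ht
    rw [Finset.mem_inter] at ht
    rw [hcount t (Finset.mem_union_left _ ht.1)]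
    exact h₁₂ t ht.1 ht.2
  have hinter : S₁ ∩ S₂ ⊆ S₁ ∪ S₂ := Finset.inter_subset_union
  have key : (S₁ ∪ S₂).card + (S₁ ∩ S₂).card ≤ ∑ t ∈ S₁ ∪ S₂, M.count t := by
    rw [← Finset.sum_sdiff hinter, Finset.card_eq_sum_ones (S₁ ∪ S₂), ← Finset.sum_sdiff hinter,
      Finset.card_eq_sum_ones]
    have hA : ∑ t ∈ (S₁ ∪ S₂) \ (S₁ ∩ S₂), (1 : ℕ) ≤ ∑ t ∈ (S₁ ∪ S₂) \ (S₁ ∩ S₂), M.count t :=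
      Finset.sum_le_sum fun t ht => hge1 t (Finset.sdiff_subset ht)
    have hB : ∑ t ∈ S₁ ∩ S₂, (1 : ℕ) + ∑ t ∈ S₁ ∩ S₂, (1 : ℕ) ≤ ∑ t ∈ S₁ ∩ S₂, M.count t := by
      rw [← Finset.sum_add_distrib]
      exact Finset.sum_le_sum fun t ht => hge2 t ht
    omega
  calc S₁.card + S₂.card = (S₁ ∪ S₂).card + (S₁ ∩ S₂).card := (Finset.card_union_add_card_inter S₁ S₂).symm
    _ ≤ ∑ t ∈ S₁ ∪ S₂, M.count t := key
    _ ≤ ∑ t ∈ M.toFinset, M.count t := Finset.sum_le_sum_of_subset hsub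
    _ = Multiset.card M := hsum.symm

/-- **`PeelInequality` at rank two, curve form.** [folklore] -/
theorem peel_curve_two (a e f : ℝ[X]) (c : ℝ) (N : ℕ) (hc : 0 < c) (ha0 : a ≠ 0) (hf0 : f ≠ 0)
    (hΔ : ∀ t, 4 * a.eval t * f.eval t ≤ e.eval t ^ 2) (Φ : MvPolynomial (Fin 2) ℝ)
    (hΦ : Φ = MvPolynomial.X 1 * MvPolynomial.X 1 * Polynomial.aeval (MvPolynomial.X 0 : MvPolynomial (Fin 2) ℝ) a
        + MvPolynomial.X 1 * Polynomial.aeval (MvPolynomial.X 0 : MvPolynomial (Fin 2) ℝ) e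
        + Polynomial.aeval (MvPolynomial.X 0 : MvPolynomial (Fin 2) ℝ) f)
    (hfin : {p : Fin 2 → ℝ | 0 < p 0 ∧ 0 < p 1 ∧ MvPolynomial.eval p Φ = 0 ∧
      MvPolynomial.eval p
        (MvPolynomial.X 0 * MvPolynomial.pderiv 0 (MvPolynomial.X 0 * MvPolynomial.pderiv 0 Φ)
            * (MvPolynomial.X 1 * MvPolynomial.pderiv 1 Φ) ^ 2
          - 2 * (MvPolynomial.X 0 * MvPolynomial.pderiv 0 (MvPolynomial.X 1 * MvPolynomial.pderiv 1 Φ))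
            * (MvPolynomial.X 0 * MvPolynomial.pderiv 0 Φ) * (MvPolynomial.X 1 * MvPolynomial.pderiv 1 Φ)
          + MvPolynomial.X 1 * MvPolynomial.pderiv 1 (MvPolynomial.X 1 * MvPolynomial.pderiv 1 Φ)
            * (MvPolynomial.X 0 * MvPolynomial.pderiv 0 Φ) ^ 2) = 0}.Finite)
    (hgp : ∀ p ∈ {p : Fin 2 → ℝ | 0 < p 0 ∧ 0 < p 1 ∧ MvPolynomial.eval p Φ = 0 ∧
      MvPolynomial.eval p
        (MvPolynomial.X 0 * MvPolynomial.pderiv 0 (MvPolynomial.X 0 * MvPolynomial.pderiv 0 Φ)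
            * (MvPolynomial.X 1 * MvPolynomial.pderiv 1 Φ) ^ 2
          - 2 * (MvPolynomial.X 0 * MvPolynomial.pderiv 0 (MvPolynomial.X 1 * MvPolynomial.pderiv 1 Φ))
            * (MvPolynomial.X 0 * MvPolynomial.pderiv 0 Φ) * (MvPolynomial.X 1 * MvPolynomial.pderiv 1 Φ)
          + MvPolynomial.X 1 * MvPolynomial.pderiv 1 (MvPolynomial.X 1 * MvPolynomial.pderiv 1 Φ)
            * (MvPolynomial.X 0 * MvPolynomial.pderiv 0 Φ) ^ 2) = 0},
        MvPolynomial.eval p (MvPolynomial.pderiv 1 Φ) ≠ 0 ∧ p 1 ≠ c * p 0 ^ N) :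
    Multiset.card ((a * (C c * X ^ N) ^ 2 + e * (C c * X ^ N) + f).roots.filter (fun t => 0 < t)) ≤
      2 * {p : Fin 2 → ℝ | 0 < p 0 ∧ 0 < p 1 ∧ MvPolynomial.eval p Φ = 0 ∧
      MvPolynomial.eval p
        (MvPolynomial.X 0 * MvPolynomial.pderiv 0 (MvPolynomial.X 0 * MvPolynomial.pderiv 0 Φ)
            * (MvPolynomial.X 1 * MvPolynomial.pderiv 1 Φ) ^ 2
          - 2 * (MvPolynomial.X 0 * MvPolynomial.pderiv 0 (MvPolynomial.X 1 * MvPolynomial.pderiv 1 Φ))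
            * (MvPolynomial.X 0 * MvPolynomial.pderiv 0 Φ) * (MvPolynomial.X 1 * MvPolynomial.pderiv 1 Φ)
          + MvPolynomial.X 1 * MvPolynomial.pderiv 1 (MvPolynomial.X 1 * MvPolynomial.pderiv 1 Φ)
            * (MvPolynomial.X 0 * MvPolynomial.pderiv 0 Φ) ^ 2) = 0}.ncard + 2 * 2
        + 2 * Multiset.card (f.roots.filter (fun t => 0 < t)) + 3 * Multiset.card (a.roots.filter (fun t => 0 < t)) := by
  classical
  set osc := {p : Fin 2 → ℝ | 0 < p 0 ∧ 0 < p 1 ∧ MvPolynomial.eval p Φ = 0 ∧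
      MvPolynomial.eval p
        (MvPolynomial.X 0 * MvPolynomial.pderiv 0 (MvPolynomial.X 0 * MvPolynomial.pderiv 0 Φ)
            * (MvPolynomial.X 1 * MvPolynomial.pderiv 1 Φ) ^ 2
          - 2 * (MvPolynomial.X 0 * MvPolynomial.pderiv 0 (MvPolynomial.X 1 * MvPolynomial.pderiv 1 Φ))
            * (MvPolynomial.X 0 * MvPolynomial.pderiv 0 Φ) * (MvPolynomial.X 1 * MvPolynomial.pderiv 1 Φ)
          + MvPolynomial.X 1 * MvPolynomial.pderiv 1 (MvPolynomial.X 1 * MvPolynomial.pderiv 1 Φ)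
            * (MvPolynomial.X 0 * MvPolynomial.pderiv 0 Φ) ^ 2) = 0} with hosc
  set g : ℝ[X] := a * (C c * X ^ N) ^ 2 + e * (C c * X ^ N) + f with hg
  -- the two branches
  set β : ℝ → ℝ → ℝ := fun σ t => if a.eval t = 0 then -f.eval t / e.eval t
    else (-e.eval t + σ * Real.sqrt (e.eval t ^ 2 - 4 * a.eval t * f.eval t)) / (2 * a.eval t) with hβ
  have hβσ : ∀ σ t, β σ t = if a.eval t = 0 then -f.eval t / e.eval t
      else (-e.eval t + σ * Real.sqrt (e.eval t ^ 2 - 4 * a.eval t * f.eval t)) / (2 * a.eval t) := fun σ t => rfl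
  have hge : ∀ t, g.eval t = MvPolynomial.eval ![t, c * t ^ N] Φ := fun t => by
    rw [hΦ, eval_Phi₂]; simp only [hg, Matrix.cons_val_one, Matrix.cons_val_zero, eval_add, eval_mul, eval_pow,
      eval_C, eval_X]; ring
  have hgeval : ∀ t, g.eval t = a.eval t * (c * t ^ N) ^ 2 + e.eval t * (c * t ^ N) + f.eval t := fun t => by
    simp only [hg, eval_add, eval_mul, eval_pow, eval_C, eval_X]
  by_cases hg0 : g = 0
  · simp [hg0]
  -- no vertical ray
  have hray : ∀ t, 0 < t → a.eval t = 0 → e.eval t = 0 → f.eval t = 0 → False := fun t ht ha he hf =>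
    not_finite_of_vertical_ray a e f Φ hΦ ht ha he hf hfin
  -- positive roots: on branch `+` (owned) or on branch `−` (owned)
  set own : ℝ → ℝ → Prop := fun σ t => β σ t = c * t ^ N ∧ (a.eval t ≠ 0 ∨ 0 < σ * e.eval t) with hown
  have hroots : ∀ t, 0 < t → g.IsRoot t → own 1 t ∨ own (-1) t := by
    intro t ht hr
    have hr' : a.eval t * (c * t ^ N) ^ 2 + e.eval t * (c * t ^ N) + f.eval t = 0 := by rw [← hgeval]; exact hr
    have hb : 0 < c * t ^ N := mul_pos hc (pow_pos ht N)
    by_cases ha : a.eval t = 0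
    · have he : e.eval t ≠ 0 := by
        intro he
        rw [ha, he] at hr'
        exact hray t ht ha he (by linarith)
      have hval : β 1 t = c * t ^ N ∧ β (-1) t = c * t ^ N := by
        rw [hβσ, hβσ, if_pos ha, if_pos ha]
        rw [ha] at hr'
        constructor <;> · field_simp; linarith
      rcases lt_or_gt_of_ne he with hlt | hlt
      · exact Or.inr ⟨hval.2, Or.inr (by linarith)⟩
      · exact Or.inl ⟨hval.1, Or.inr (by linarith)⟩
    · rcases (quad_root_iff ha (hΔ t) (c * t ^ N)).1 hr' with h | h
      · left; refine ⟨?_, Or.inl ha⟩; rw [hβσ, if_neg ha, h, one_mul]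
      · right; refine ⟨?_, Or.inl ha⟩; rw [hβσ, if_neg ha, h]; ring
  -- cut finsets
  set Zf : ℝ → Finset ℝ := fun σ => f.roots.toFinset.filter (fun t => 0 < t ∧ 0 ≤ σ * e.eval t) with hZf
  set Esc : ℝ → Finset ℝ := fun σ => a.roots.toFinset.filter (fun t => 0 < t ∧ σ * e.eval t ≤ 0) with hEsc
  set Oσ : ℝ → Finset ℝ := fun σ => (hfin.toFinset.filter
    (fun p => p 1 = β σ (p 0) ∧ (a.eval (p 0) ≠ 0 ∨ 0 < σ * e.eval (p 0)))).image (fun p => p 0) with hOσ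
  set P : ℝ → Finset ℝ := fun σ => (Zf σ ∪ Esc σ) ∪ Oσ σ with hP
  -- (1) the zero cuts cost at most `Z₊mult(f)`
  have hZf_le : (Zf 1).card + (Zf (-1)).card ≤ Multiset.card (f.roots.filter (fun t => 0 < t)) := by
    refine card_add_card_le_card_roots f hf0 _ _ (fun t ht => ?_) (fun t ht => ?_) (fun t h1 h2 => ?_)
    · simp only [hZf, Finset.mem_filter, Multiset.mem_toFinset, mem_roots hf0] at ht; exact ⟨ht.2.1, ht.1⟩
    · simp only [hZf, Finset.mem_filter, Multiset.mem_toFinset, mem_roots hf0] at ht; exact ⟨ht.2.1, ht.1⟩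
    · simp only [hZf, Finset.mem_filter, Multiset.mem_toFinset, mem_roots hf0] at h1 h2
      have he : e.eval t = 0 := by have := h1.2.2; have := h2.2.2; linarith
      have ha : a.eval t ≠ 0 := fun ha => hray t h1.2.1 ha he h1.1
      exact one_lt_rootMultiplicity_of_eval_e_eq_zero a e f hΔ hf0 ha h1.1 he
  -- (2) the escape cuts cost at most `Z₊mult(a)`
  have hEsc_le : (Esc 1).card + (Esc (-1)).card ≤ Multiset.card (a.roots.filter (fun t => 0 < t)) := by
    refine card_add_card_le_card_roots a ha0 _ _ (fun t ht => ?_) (fun t ht => ?_) (fun t h1 h2 => ?_)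
    · simp only [hEsc, Finset.mem_filter, Multiset.mem_toFinset, mem_roots ha0] at ht; exact ⟨ht.2.1, ht.1⟩
    · simp only [hEsc, Finset.mem_filter, Multiset.mem_toFinset, mem_roots ha0] at ht; exact ⟨ht.2.1, ht.1⟩
    · simp only [hEsc, Finset.mem_filter, Multiset.mem_toFinset, mem_roots ha0] at h1 h2
      have he : e.eval t = 0 := by have := h1.2.2; have := h2.2.2; linarith
      have hf : f.eval t ≠ 0 := fun hf => hray t h1.2.1 h1.1 he hf
      exact one_lt_rootMultiplicity_of_eval_e_eq_zero' a e f hΔ ha0 h1.1 he hf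
  -- (3) the osculation cuts cost at most `#osc` (the two branch families are disjoint)
  have hO_le : (Oσ 1).card + (Oσ (-1)).card ≤ osc.ncard := by
    have hdisj : Disjoint (hfin.toFinset.filter (fun p => p 1 = β 1 (p 0) ∧ (a.eval (p 0) ≠ 0 ∨ 0 < 1 * e.eval (p 0))))
        (hfin.toFinset.filter (fun p => p 1 = β (-1) (p 0) ∧ (a.eval (p 0) ≠ 0 ∨ 0 < (-1) * e.eval (p 0)))) := by
      rw [Finset.disjoint_filter]
      intro p hp h1 h2
      have hposc : p ∈ osc := (Set.Finite.mem_toFinset hfin).1 hp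
      by_cases ha : a.eval (p 0) = 0
      · rcases h1.2 with h | h
        · exact h ha
        rcases h2.2 with h' | h'
        · exact h' ha
        linarith
      · -- both branches through `p`: `√Δ = 0`, so `∂_bΦ(p) = 0`
        have e1 := h1.1; have e2 := h2.1
        rw [hβσ, if_neg ha] at e1 e2
        have hsq : Real.sqrt (e.eval (p 0) ^ 2 - 4 * a.eval (p 0) * f.eval (p 0)) = 0 := by
          have : (-e.eval (p 0) + 1 * Real.sqrt (e.eval (p 0) ^ 2 - 4 * a.eval (p 0) * f.eval (p 0))) =
              (-e.eval (p 0) + (-1) * Real.sqrt (e.eval (p 0) ^ 2 - 4 * a.eval (p 0) * f.eval (p 0))) :=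
            (div_left_inj' (mul_ne_zero two_ne_zero ha)).1 (e1.symm.trans e2)
          linarith
        apply (hgp p hposc).1
        rw [hΦ, eval_pderiv_one_Phi₂]
        have := two_mul_r_add (e := e.eval (p 0)) (f := f.eval (p 0)) (σ := 1) ha
        rw [← e1, hsq, mul_zero] at this
        linear_combination this
    have hcard := Finset.card_union_of_disjoint hdisj
    have hsub : (hfin.toFinset.filter (fun p => p 1 = β 1 (p 0) ∧ (a.eval (p 0) ≠ 0 ∨ 0 < 1 * e.eval (p 0)))) ∪
        (hfin.toFinset.filter (fun p => p 1 = β (-1) (p 0) ∧ (a.eval (p 0) ≠ 0 ∨ 0 < (-1) * e.eval (p 0)))) ⊆ hfin.toFinset :=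
      Finset.union_subset (Finset.filter_subset _ _) (Finset.filter_subset _ _)
    have h3 := Finset.card_le_card hsub
    rw [Set.ncard_eq_toFinset_card osc hfin]
    calc (Oσ 1).card + (Oσ (-1)).card ≤ _ + _ := Nat.add_le_add Finset.card_image_le Finset.card_image_le
      _ ≤ hfin.toFinset.card := by rw [← hcard]; exact h3
  -- (4) per branch: roots avoid their own cuts, and every own-cut-free arc carries at most two of them
  have hbranch : ∀ σ : ℝ, σ = 1 ∨ σ = -1 →
      Multiset.card ((g.roots.filter (fun t => 0 < t)).filter (own σ)) ≤ 2 * ((P σ).card + 1) := by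
    intro σ hσ
    have hσ1 : σ * σ = 1 := by rcases hσ with rfl | rfl <;> norm_num
    refine card_le_mul_card_cuts_succ _ (P σ) 2 (fun t ht => ?_) (fun t ht => ?_) (fun L U hL hnoP => ?_)
    · exact (Multiset.mem_filter.1 (Multiset.mem_filter.1 ht).1).2
    · -- own cuts are avoided
      obtain ⟨ht, hownt⟩ := Multiset.mem_filter.1 ht
      obtain ⟨hgt, htpos⟩ := Multiset.mem_filter.1 ht
      have hroot : g.IsRoot t := (mem_roots hg0).1 hgt
      have hb : 0 < c * t ^ N := mul_pos hc (pow_pos htpos N)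
      have hr' : a.eval t * (c * t ^ N) ^ 2 + e.eval t * (c * t ^ N) + f.eval t = 0 := by rw [← hgeval]; exact hroot
      intro hmem
      simp only [hP, Finset.mem_union] at hmem
      rcases hmem with (hz | hesc) | ho
      · -- own zero: `f(t) = 0`, `σ e ≥ 0`: then branch `σ` is the ZERO root, not `c t^N > 0`
        simp only [hZf, Finset.mem_filter, Multiset.mem_toFinset, mem_roots hf0] at hz
        have hft : f.eval t = 0 := hz.1
        by_cases ha : a.eval t = 0
        · have he : e.eval t ≠ 0 := fun he => hray t htpos ha he hft
          have : β σ t = 0 := by rw [hβσ, if_pos ha, hft]; simp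
          rw [hownt.1] at this; exact absurd this hb.ne'
        · have hval := hownt.1
          rw [hβσ, if_neg ha, hft] at hval
          -- `√(e²) = |e|`, and `σ e ≥ 0` makes the numerator `−e + σ|e| = 0`
          have hsq : Real.sqrt (e.eval t ^ 2 - 4 * a.eval t * 0) = |e.eval t| := by simp [Real.sqrt_sq_eq_abs]
          rw [hsq] at hval
          have hnum : -e.eval t + σ * |e.eval t| = 0 := by
            rcases hσ with rfl | rfl
            · have h0 : 0 ≤ e.eval t := by have := hz.2.2; linarith
              rw [abs_of_nonneg h0]; ring
            · have h0 : e.eval t ≤ 0 := by have := hz.2.2; linarith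
              rw [abs_of_nonpos h0]; ring
          rw [hnum, zero_div] at hval
          exact absurd hval.symm hb.ne'
      · -- own escape: `a(t) = 0`, `σ e ≤ 0` contradicts ownership
        simp only [hEsc, Finset.mem_filter, Multiset.mem_toFinset, mem_roots ha0] at hesc
        rcases hownt.2 with h | h
        · exact h hesc.1
        · linarith [hesc.2.2]
      · -- own osculation abscissa: the osculation point would lie ON the arc
        simp only [hOσ, Finset.mem_image, Finset.mem_filter, Set.Finite.mem_toFinset] at ho
        obtain ⟨p, ⟨hp, hp1, -⟩, hp0⟩ := ho
        apply (hgp p hp).2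
        rw [hp1, hp0, hownt.1]
    · -- an own-cut-free arc `(L, U)`: at most two roots of branch `σ` there
      have hesc : ∀ t, L < t → t < U → a.eval t ≠ 0 ∨ 0 < σ * e.eval t := by
        intro t h1 h2
        by_cases ha : a.eval t = 0
        · right
          by_contra hle
          push Not at hle
          exact hnoP t (by
            simp only [hP, Finset.mem_union, hEsc, Finset.mem_filter, Multiset.mem_toFinset, mem_roots ha0]
            exact Or.inl (Or.inr ⟨ha, hL.trans_lt h1, hle⟩)) ⟨h1, h2⟩
        · exact Or.inl ha
      have hzero : ∀ t, L < t → t < U → f.eval t = 0 → σ * e.eval t < 0 := by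
        intro t h1 h2 hft
        by_contra hle
        push Not at hle
        exact hnoP t (by
          simp only [hP, Finset.mem_union, hZf, Finset.mem_filter, Multiset.mem_toFinset, mem_roots hf0]
          exact Or.inl (Or.inl ⟨hft, hL.trans_lt h1, hle⟩)) ⟨h1, h2⟩
      have hoscfree : ∀ t, L < t → t < U → 0 < β σ t → ![t, β σ t] ∉ osc := by
        intro t h1 h2 hpos hmem
        refine hnoP t ?_ ⟨h1, h2⟩
        simp only [hP, Finset.mem_union, hOσ, Finset.mem_image, Finset.mem_filter, Set.Finite.mem_toFinset]
        refine Or.inr ⟨![t, β σ t], ⟨hmem, by simp, ?_⟩, by simp⟩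
        simpa using hesc t h1 h2
      have harc := branch_arc_count_two a e f σ (β σ) (hβσ σ) ha0 hΔ hσ c N hc Φ hΦ g hge
        (fun p hp => (hgp p hp).1) hL hesc hzero hoscfree
      refine le_trans (Multiset.card_le_card ?_) harc
      rw [Multiset.filter_filter, Multiset.filter_filter]
      refine Multiset.monotone_filter_right g.roots ?_
      intro t ⟨⟨⟨h1, h2⟩, hown'⟩, _⟩
      exact ⟨h1, h2, hown'.1⟩
  -- (5) summation
  have hsplit : Multiset.card (g.roots.filter (fun t => 0 < t)) ≤
      Multiset.card ((g.roots.filter (fun t => 0 < t)).filter (own 1))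
        + Multiset.card ((g.roots.filter (fun t => 0 < t)).filter (own (-1))) := by
    have hadd := congrArg Multiset.card (Multiset.filter_add_not (own 1) (g.roots.filter (fun t => 0 < t)))
    rw [Multiset.card_add] at hadd
    have hle : Multiset.card ((g.roots.filter (fun t => 0 < t)).filter (fun t => ¬ own 1 t)) ≤
        Multiset.card ((g.roots.filter (fun t => 0 < t)).filter (own (-1))) := by
      rw [Multiset.filter_congr (p := fun t => ¬ own 1 t) (q := fun t => ¬ own 1 t ∧ own (-1) t)
        (s := g.roots.filter (fun t => 0 < t)) (fun t ht => ⟨fun h => ⟨h, ?_⟩, fun h => h.1⟩)]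
      · exact Multiset.card_le_card (Multiset.monotone_filter_right _ (fun t h => h.2))
      · obtain ⟨hgt, htpos⟩ := Multiset.mem_filter.1 ht
        exact (hroots t htpos ((mem_roots hg0).1 hgt)).resolve_left h
    omega
  have hP_le : ∀ σ, (P σ).card ≤ (Zf σ).card + (Esc σ).card + (Oσ σ).card := fun σ =>
    (Finset.card_union_le _ _).trans (Nat.add_le_add_right (Finset.card_union_le _ _) _)
  have h1 := hbranch 1 (Or.inl rfl)
  have h2 := hbranch (-1) (Or.inr rfl)
  have hP1 := hP_le 1
  have hP2 := hP_le (-1)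
  omega

end OsculationPeel

end Summit.ValiantsHypothesis.ValiantsHypothesis.Theorems.LacunarySymmetroidMatrixDescartes

end
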